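import Summits.QuantumFields.BalabanUV.T4Continuum.Spine.NE7b.LocalConditionalStability
import Literature.MathematicalPhysics.QuantumFieldTheory.Balaban1983to89.T4ShellMeasureSocket
import Literature.MathematicalPhysics.QuantumFieldTheory.Balaban1983to89.B16Sect1SmallFactors

/-!
# `T4Continuum.Spine.NE7c.LiveFactorLCS` — spine estimate NE7c (node U5b), road (δ) THRESHOLD RANDOMISATION:
# the NE7b road's ONE residual one-step lemma «LCS-j» (`Spine/NE7b/LocalConditionalStability`, p358003: the two named
# halves `PointwiseExtraction` ∕ `LocCondStability` + the cost–volume ledger) READ WITH THE LIVE FACTOR — the extraction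
# half carries `λ₀²` (census class C1), the stability half is letter-blind, the ledger keeps an explicit fraction of
# print's surplus below ONE `g⋆(λ₀)`, and the road's keyed `ExtractionLaws` hold for EVERY grid assignment of a
# threshold-parametric tower family with ONE assignment-free quotient
# (cell `pub-balaban-gaps`, track G2, seat ne8 gen 10, file 15; record `HOME/ne/NE7c.md` §17)

HONEST FRAMING.  Finite four-torus programme, rung (B)+1 only — NOT infinite volume, NOT a mass gap, NOT the Clay
problem, NOT summit progress, NOT a proof of NE7c (`T4IndicatorShell.ShellWeightBound`, INSTANCE 0∕1, which waits on
node O ∕ the (A1c) instance) and NOT a proof of NE7b (`T4WeightBudget.RelWeightBound`, NOT PRINTED, NOT PROVED).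
Nothing of [Bałaban 1983–89] is asserted: threshold randomisation (road (δ)) is the cell's device; `PointwiseExtraction`
and `LocCondStability` are the NE7b road's named `Prop`s over an ABSTRACT history tower (gaps-ne6 g8), CONSUMED BY NAME,
nothing edited; everything below is real arithmetic and Bochner monotonicity over that abstract tower.  Every input is
an explicit hypothesis; no `def`; 0 sorry.  Spine PROVED 0∕9 — unchanged by this file.

WHY (interface, located).  OWNER RULING W-ne7bp1-g104-4 (journal l.51421) released the ONE-STEP END re-cut IR-104-2 as a
SPEC: the END-to-be's record replaces the per-class extraction displays `extractA ∕ extractB` by, per pinned event along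
`keyPattern`, the two halves `pwA : PointwiseExtraction …` + `lcsA : LocCondStability …`, the window ledger
`Σ_{events of the component} (b − a) ≤ −(surplus)` ((1.80)-shaped, NEVER a per-step letter), and print's exponent-condition
letters; road: `extractionLaws_of_LCS_of_subset` + `hread_keyPattern` ⇒ `extractA` DERIVED.  Road (δ)'s junction word
for every END of the NE7b lineage (files 7∕9∕14: J4, 2R, IR-103-1) is «the (A1c-0) builder is THRESHOLD-PARAMETRIC over a
FIXED `branch` (C-ρ-TOWER) and every assignment-dependent displayed row is owed for ALL grid assignments» — so the
question this file answers is located: WHICH of the three new rows sees the assignment, and at what price.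
* The EXTRACTION half sees it (census class C1, the ONE loss family of road (δ)): a pinned large-field event at a
  LOWERED threshold `μ·θ`, `μ ∈ [λ₀, 1]`, extracts `e^{−δμθ} ≤ e^{−δλ₀θ}` by print's own Chebyshev split
  (`chebyshev_extraction_live`; `…_sq` for the quadratic dictionary `Q ≥ (με)²`, the `λ₀²` of `LiveFactorLargeField`);
  abstractly `PointwiseExtraction` is ANTITONE in its exponents (`pointwiseExtraction_anti ∕ _live`).
* The STABILITY half does NOT (census classes C2–C5, free): `LocCondStability` constrains the carrier's conditional
  moment in the term's OWN state with an exponent `b` = print's `exp O(1)|Z_j ∩ Ω_j|` ([Balaban1989LargeFieldII] p. 383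
  l. 21–28, refuter F353: `O(1)M^dR_n^{d+1}d′_n` per live component per step, inheriting `log g_j⁻²` from p. 380's
  normalisation constants) — a letter that never reads a threshold VALUE; abstractly it is MONOTONE in `b`
  (`locCondStability_mono`), which is all a uniform majorant `bU` over the grid needs.
* The LEDGER pays the located price: along every pattern history, termwise domination `b ≤ κ·a₁` of the stability
  exponents by print's extraction profile `a₁` and live extraction `a ≥ λ₀²·a₁` leave the surplus
  `(λ₀² − κ)·Σ a₁ ≥ (λ₀² − κ)·c₁` of print's `c₁ ≤ Σ(a₁ − b)` (`step_surplus_live`, `surplus_live`, `costVolume_live`;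
  `sumAlong_mono ∕ _smul ∕ _nonneg`); hence the class display `sum_admS_integral_le_of_LCS` AT LIVE EXPONENTS with the
  constant `(λ₀² − κ)·c₁` (`sum_admS_integral_le_of_LCS_live`).  In print's exponent letters (`Lit.p0Profile A p g =
  A(log g⁻²)^p`): `b ≤ B·ℓ^q`, `a₁ = A·ℓ^p`, `q < p` (print's STRICT exponent conditions — the located condition p. 385 of
  the (1.80)-induction, `LiveFactorKappaInduction`; the p. 383 proviso, `LiveFactorLargeField`) give `κ = λ₀²∕2` once
  `ℓ ≥ max 1 (2B∕(λ₀²A))`, i.e. for `g ≤ exp(−½·max 1 (2B∕(λ₀²A)))` — ONE `g⋆(λ₀)` (`dominance_live_of_ell_ge ∕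
  _of_g_small`, by `Lit.T4ShellMeasureSocket.liveFactor_margin_p0Profile` BY NAME): live surplus `½λ₀²·c₁`.
* ONE QUOTIENT FOR ALL ASSIGNMENTS: for a threshold-parametric family the road's keyed laws
  `PinnedExtraction.ExtractionLaws` with per-assignment quotients `q c ≤ qU` hold with the assignment-FREE `qU`
  (`extractionLaws_uniform_of_parametric`, `ExtractionLaws.mono` BY NAME); with LCS-j quotients
  `Π_{j<K} e^{b c − a c} ≤ Π_{j<K} e^{bU − λ₀²a₁}` (`prod_exp_sub_le_of_live`) — so the cell's COUNT over the quotients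
  (IR-103-2's price sentences, END3's ledger) is certified ONCE, at the live letters, for every grid assignment: the shape
  `LiveFactorTowerShell.nonempty_towerExtraction_of_parametric`'s builder owes.
NET EFFECT ON THE WALL: NONE new — (L1-step) applied to IR-104-2's three new rows: one C1 row (kernel here and, in print's
letters, in files 1∕3∕5), two free rows.  NE7c NOT proved; node O unchanged.  HONEST DEPENDENCY (cell): continuum YM on
T⁴ ⇐ BetaPertH ∧ nine spine estimates (0∕9 proved); BetaPertH ⇐ (D1) ∧ (D4) ∧ CAP+tail.  This file changes none of it.
-/

namespace Summit.QuantumFields.BalabanUV.T4Continuum.Spine.NE7c.LiveFactorLCS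

open Finset MeasureTheory Real
open Literature.MathematicalPhysics.QuantumFieldTheory.Balaban1983to89
open Literature.MathematicalPhysics.QuantumFieldTheory.Balaban1983to89.T4ShellMeasureSocket
open Summit.QuantumFields.BalabanUV.T4Continuum.B16HistoryIndexedRepr
open Summit.QuantumFields.BalabanUV.T4Continuum.B16HistoryReprChain
open Summit.QuantumFields.BalabanUV.T4Continuum.B16HistoryReprInstance
open Summit.QuantumFields.BalabanUV.T4Continuum.NE7b.PinnedExtraction
open Summit.QuantumFields.BalabanUV.T4Continuum.NE7b.PrefixExtraction
open Summit.QuantumFields.BalabanUV.T4Continuum.NE7b.PrefixExtractionLaws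
open Summit.QuantumFields.BalabanUV.T4Continuum.NE7b.LocalConditionalStability

/-! ## §1 The extraction half under the live factor: print's Chebyshev split at a lowered threshold -/

section Chebyshev

variable {X ι : Type*}

/-- **THE CHEBYSHEV SPLIT AT A LOWERED THRESHOLD** (census class C1 in LCS-j's currency).  Characteristic functions
summing to at most `1`, each supported where `Q ≥ μ·θ` — the pinned large-field event of the run whose live threshold is
lowered by a factor `μ ≥ λ₀` (`θ ≥ 0`) — extract at least `e^{−δλ₀θ}` against the sacrificed part `e^{δQ}`:
`Σ χ_i ≤ e^{−δλ₀θ}·e^{δQ}`, uniformly in `μ ≥ λ₀` (`LocalConditionalStability.chebyshev_extraction` at `μθ`, then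
monotonicity of `exp`). [folklore] -/
theorem chebyshev_extraction_live (s : Finset ι) (χ : ι → X → ℝ) (Q : X → ℝ) {θ δ lam₀ μ : ℝ} (hδ : 0 ≤ δ)
    (hθ : 0 ≤ θ) (hμ : lam₀ ≤ μ) (hχ1 : ∀ y, ∑ i ∈ s, χ i y ≤ 1)
    (hsupp : ∀ i ∈ s, ∀ y, χ i y ≠ 0 → μ * θ ≤ Q y) (y : X) :
    ∑ i ∈ s, χ i y ≤ exp (-(δ * (lam₀ * θ))) * exp (δ * Q y) := by
  refine (chebyshev_extraction s χ Q hδ hχ1 hsupp y).trans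
    (mul_le_mul_of_nonneg_right (exp_le_exp.2 ?_) (exp_pos _).le)
  have h : δ * (lam₀ * θ) ≤ δ * (μ * θ) := mul_le_mul_of_nonneg_left (mul_le_mul_of_nonneg_right hμ hθ) hδ
  linarith

/-- **THE QUADRATIC DICTIONARY** (the action is quadratic in the tested variable: the event reads `Q ≥ (μ·ε)²` for the
lowered threshold `μ·ε`, `μ ≥ λ₀ ≥ 0` — [III] (2.2)–(2.4), `LiveFactorLargeField.live_dictionary`): the extracted exponent
carries `λ₀²`, `Σ χ_i ≤ e^{−δλ₀²ε²}·e^{δQ}`. [folklore] -/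
theorem chebyshev_extraction_live_sq (s : Finset ι) (χ : ι → X → ℝ) (Q : X → ℝ) {ε δ lam₀ μ : ℝ} (hδ : 0 ≤ δ)
    (h0 : 0 ≤ lam₀) (hμ : lam₀ ≤ μ) (hχ1 : ∀ y, ∑ i ∈ s, χ i y ≤ 1)
    (hsupp : ∀ i ∈ s, ∀ y, χ i y ≠ 0 → (μ * ε) ^ 2 ≤ Q y) (y : X) :
    ∑ i ∈ s, χ i y ≤ exp (-(δ * (lam₀ ^ 2 * ε ^ 2))) * exp (δ * Q y) := by
  refine (chebyshev_extraction s χ Q hδ hχ1 hsupp y).trans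
    (mul_le_mul_of_nonneg_right (exp_le_exp.2 ?_) (exp_pos _).le)
  have h1 : lam₀ ^ 2 * ε ^ 2 ≤ (μ * ε) ^ 2 := by
    rw [mul_pow]
    exact mul_le_mul_of_nonneg_right (pow_le_pow_left₀ h0 hμ 2) (sq_nonneg _)
  have h2 : δ * (lam₀ ^ 2 * ε ^ 2) ≤ δ * (μ * ε) ^ 2 := mul_le_mul_of_nonneg_left h1 hδ
  linarith

end Chebyshev

/-! ## §2 The two halves over one tower: `PointwiseExtraction` is antitone in `a`, `LocCondStability` monotone in `b` -/

section Halves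

variable {P : Type} [DecidableEq P] {C : ℕ → Type} {𝒢 : (j : ℕ) → GoodClass (C j)} {T : Tower P C 𝒢}
  {S : (j : ℕ) → (Fin j → P) → Finset P} {K : ℕ} {χ : (j : ℕ) → (Fin j → P) → P → C j → ℝ}
  {M : (j : ℕ) → (Fin j → P) → C j → ℝ} {a a' b b' : (j : ℕ) → (Fin j → P) → ℝ}

/-- **`PointwiseExtraction` IS ANTITONE IN THE EXTRACTED EXPONENTS** (non-negative carrier): extracting `a` extracts every
`a' ≤ a` at the pattern prefixes. [folklore] -/
theorem pointwiseExtraction_anti (hM : ∀ j g y, 0 ≤ M j g y)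
    (hle : ∀ j g, j < K → g ∈ admS T S j → a' j g ≤ a j g) (h : PointwiseExtraction T S K χ M a) :
    PointwiseExtraction T S K χ M a' := fun j g hj hg y =>
  (h j g hj hg y).trans (mul_le_mul_of_nonneg_right (exp_le_exp.2 (neg_le_neg (hle j g hj hg))) (hM j g y))

/-- **THE EXTRACTION HALF AT THE LIVE LETTERS**: a tower (the lowered-threshold run at some grid assignment) whose pinned
events extract exponents `a ≥ λ₀²·a₁` — `a₁` an assignment-FREE profile of the labels (print's `p₀(g_j)`-type letters
read off level and history, C-ρ-TOWER) — satisfies `PointwiseExtraction` with the assignment-free exponents `λ₀²·a₁`.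
[folklore] -/
theorem pointwiseExtraction_live {lam₀ : ℝ} {a₁ : (j : ℕ) → (Fin j → P) → ℝ} (hM : ∀ j g y, 0 ≤ M j g y)
    (hle : ∀ j g, j < K → g ∈ admS T S j → lam₀ ^ 2 * a₁ j g ≤ a j g) (h : PointwiseExtraction T S K χ M a) :
    PointwiseExtraction T S K χ M (fun j g => lam₀ ^ 2 * a₁ j g) :=
  pointwiseExtraction_anti hM hle h

variable [∀ j, MeasurableSpace (C j)] {μ : (j : ℕ) → Measure (C j)} {ρ₀ : C 0 → ℝ}

/-- **`LocCondStability` IS MONOTONE IN THE STABILITY EXPONENTS** (good non-negative `ρ₀`, so the un-pinned term has a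
non-negative integral): the half is LETTER-BLIND to thresholds given its carrier, and a uniform majorant `b' ≥ b` over the
grid is again an inhabitant — census classes C2–C5 (free). [folklore] -/
theorem locCondStability_mono (hρ : (𝒢 0).Gd ρ₀) (h0 : ∀ x, 0 ≤ ρ₀ x)
    (hle : ∀ j g, j < K → g ∈ admS T S j → b j g ≤ b' j g) (h : LocCondStability T S K μ ρ₀ M b) :
    LocCondStability T S K μ ρ₀ M b' := fun j g hj hg =>
  ⟨(h j g hj hg).1, (h j g hj hg).2.trans (mul_le_mul_of_nonneg_right (exp_le_exp.2 (hle j g hj hg))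
    (integral_eterm_nonneg T μ hρ h0 j g))⟩

end Halves

/-! ## §3 The cost–volume ledger under the live factor -/

section Ledger

variable {P : Type}

/-- `sumAlong` is monotone in the exponent family. [folklore] -/
theorem sumAlong_mono {f f' : (j : ℕ) → (Fin j → P) → ℝ} (h : ∀ j g, f j g ≤ f' j g) :
    ∀ (K : ℕ) (h' : Fin K → P), sumAlong f K h' ≤ sumAlong f' K h'
  | 0, _ => by simp [sumAlong]
  | K + 1, h' => by
      show sumAlong f K (Fin.init h') + f K (Fin.init h') ≤ sumAlong f' K (Fin.init h') + f' K (Fin.init h')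
      exact add_le_add (sumAlong_mono h K _) (h K _)

/-- `sumAlong` is homogeneous: a common factor comes out. [folklore] -/
theorem sumAlong_smul (c : ℝ) (f : (j : ℕ) → (Fin j → P) → ℝ) :
    ∀ (K : ℕ) (h : Fin K → P), sumAlong (fun j g => c * f j g) K h = c * sumAlong f K h
  | 0, _ => by simp [sumAlong]
  | K + 1, h => by
      show sumAlong (fun j g => c * f j g) K (Fin.init h) + c * f K (Fin.init h) =
        c * (sumAlong f K (Fin.init h) + f K (Fin.init h))
      rw [sumAlong_smul c f K (Fin.init h), mul_add]

/-- `sumAlong` of a non-negative family is non-negative. [folklore] -/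
theorem sumAlong_nonneg {f : (j : ℕ) → (Fin j → P) → ℝ} (h : ∀ j g, 0 ≤ f j g) :
    ∀ (K : ℕ) (h' : Fin K → P), 0 ≤ sumAlong f K h'
  | 0, _ => by simp [sumAlong]
  | K + 1, h' => by
      show 0 ≤ sumAlong f K (Fin.init h') + f K (Fin.init h')
      exact add_nonneg (sumAlong_nonneg h K _) (h K _)

/-- **ONE STEP OF THE LEDGER AT THE LIVE LETTERS**: stability dominated by print's extraction profile, `b ≤ κ·a₁`, and live
extraction `aL ≥ λ₀²·a₁` leave the step surplus `(λ₀² − κ)·a₁ ≤ aL − b`. [folklore] -/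
theorem step_surplus_live {a₁ b aL κ lam₀ : ℝ} (hb : b ≤ κ * a₁) (haL : lam₀ ^ 2 * a₁ ≤ aL) :
    (lam₀ ^ 2 - κ) * a₁ ≤ aL - b := by
  rw [sub_mul]
  linarith

/-- **THE LEDGER ALONG A HISTORY AT THE LIVE LETTERS**: `(λ₀² − κ)·Σ a₁ ≤ Σ aL − Σ b`. [folklore] -/
theorem surplus_live {a₁ b aL : (j : ℕ) → (Fin j → P) → ℝ} {κ lam₀ : ℝ} (hb : ∀ j g, b j g ≤ κ * a₁ j g)
    (haL : ∀ j g, lam₀ ^ 2 * a₁ j g ≤ aL j g) (K : ℕ) (h : Fin K → P) :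
    (lam₀ ^ 2 - κ) * sumAlong a₁ K h ≤ sumAlong aL K h - sumAlong b K h := by
  rw [← sumAlong_smul, ← sumAlong_sub b aL K h]
  exact sumAlong_mono (fun j g => step_surplus_live (hb j g) (haL j g)) K h

/-- **PRINT's SURPLUS SURVIVES WITH THE FRACTION `λ₀² − κ`**: print's cost–volume constant `c₁ ≤ Σ(a₁ − b)` along a
history (non-negative stability exponents, so `c₁ ≤ Σ a₁`), termwise domination `b ≤ κ·a₁` with `κ ≤ λ₀²`, and live
extraction `aL ≥ λ₀²·a₁` give the live cost–volume constant `(λ₀² − κ)·c₁ ≤ Σ(aL − b)`.  (A per-step letter `b ≤ a` is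
NOT assumed of print — ruling W-ne7bp1-g104-4 (1); `κ` is the located polylog ratio of §4.) [folklore] -/
theorem costVolume_live {a₁ b aL : (j : ℕ) → (Fin j → P) → ℝ} {κ lam₀ c₁ : ℝ} (hκ : κ ≤ lam₀ ^ 2)
    (hb0 : ∀ j g, 0 ≤ b j g) (hb : ∀ j g, b j g ≤ κ * a₁ j g) (haL : ∀ j g, lam₀ ^ 2 * a₁ j g ≤ aL j g)
    {K : ℕ} {h : Fin K → P} (hc : c₁ ≤ sumAlong a₁ K h - sumAlong b K h) :
    (lam₀ ^ 2 - κ) * c₁ ≤ sumAlong aL K h - sumAlong b K h := by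
  have hB : 0 ≤ sumAlong b K h := sumAlong_nonneg hb0 K h
  have hA : c₁ ≤ sumAlong a₁ K h := by linarith
  exact (mul_le_mul_of_nonneg_left hA (sub_nonneg.2 hκ)).trans (surplus_live hb haL K h)

end Ledger

section ClassBound

variable {P : Type} [DecidableEq P] {C : ℕ → Type} {𝒢 : (j : ℕ) → GoodClass (C j)} {T : Tower P C 𝒢}
  {S : (j : ℕ) → (Fin j → P) → Finset P} [∀ j, MeasurableSpace (C j)] {μ : (j : ℕ) → Measure (C j)} {ρ₀ : C 0 → ℝ}
  {K : ℕ} {χ : (j : ℕ) → (Fin j → P) → P → C j → ℝ} {M : (j : ℕ) → (Fin j → P) → C j → ℝ}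
  {a a₁ b : (j : ℕ) → (Fin j → P) → ℝ}

/-- **THE CLASS DISPLAY FROM «LCS-j» AT THE LIVE LETTERS.**  ONE tower (the lowered-threshold run at some grid assignment)
with its `hstep` identities and integrability display, POINTWISE EXTRACTION with exponents `a ≥ λ₀²·a₁` on the pattern
prefixes (`a₁` print's assignment-free extraction profile), LOCAL CONDITIONAL STABILITY with exponents `0 ≤ b ≤ κ·a₁`,
`κ ≤ λ₀²`, and PRINT's cost–volume constant `c₁ ≤ Σ(a₁ − b)` along every pattern history ⟹ the pattern class's
level-`K` weight is at most `e^{−(λ₀² − κ)c₁}·∫ ρ₀ dμ_0` — `LocalConditionalStability.sum_admS_integral_le_of_LCS` BY NAME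
at the exponents `λ₀²·a₁` (`pointwiseExtraction_live`) with the ledger `costVolume_live`. [folklore] -/
theorem sum_admS_integral_le_of_LCS_live (hρ : (𝒢 0).Gd ρ₀) (h0 : ∀ x, 0 ≤ ρ₀ x)
    (hstep : ∀ j g, j < K → g ∈ admS T S j → ∀ p ∈ T.branch j g, ∀ f : C j → ℝ, (𝒢 j).Gd f →
      ∫ x, (T.op j g p).T f x ∂μ (j + 1) = ∫ y, χ j g p y * f y ∂μ j)
    (hintχ : ∀ j g, j < K → g ∈ admS T S j → ∀ p ∈ T.branch j g,
      Integrable (fun y => χ j g p y * T.eterm ρ₀ j g y) (μ j))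
    (hM : ∀ j g y, 0 ≤ M j g y) (hPE : PointwiseExtraction T S K χ M a) (hLCS : LocCondStability T S K μ ρ₀ M b)
    {lam₀ κ c₁ : ℝ} (hκ : κ ≤ lam₀ ^ 2) (ha : ∀ j g, j < K → g ∈ admS T S j → lam₀ ^ 2 * a₁ j g ≤ a j g)
    (hb0 : ∀ j g, 0 ≤ b j g) (hb : ∀ j g, b j g ≤ κ * a₁ j g)
    (hcost : ∀ h ∈ admS T S K, c₁ ≤ sumAlong a₁ K h - sumAlong b K h) :
    ∑ h ∈ admS T S K, ∫ x, T.eterm ρ₀ K h x ∂μ K ≤ exp (-((lam₀ ^ 2 - κ) * c₁)) * ∫ x, ρ₀ x ∂μ 0 :=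
  sum_admS_integral_le_of_LCS hρ h0 hstep hintχ (pointwiseExtraction_live hM ha hPE) hLCS fun h hh =>
    costVolume_live hκ hb0 hb (fun _ _ => le_rfl) (hcost h hh)

end ClassBound

/-! ## §4 The located price in print's exponent letters: `κ = λ₀²∕2` below ONE `g⋆(λ₀)` -/

section Letters

/-- **STABILITY IS DOMINATED BY HALF THE LIVE EXTRACTION for `g` small depending on `λ₀` only.**  In print's profile
letters (`Lit.p0Profile A p g = A·(log g⁻²)^p`): a stability exponent below `B·ℓ^q` and an extraction profile `A·ℓ^p`
with the STRICT exponent inequality `q < p` (print's exponent conditions at each birth — [Balaban1989LargeFieldII] p. 383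
proviso, p. 385 located condition; F353) satisfy `B·ℓ^q ≤ ½λ₀²·A·ℓ^p` once `ℓ = log g⁻² ≥ max 1 (2B∕(λ₀²A))` —
`Lit.T4ShellMeasureSocket.liveFactor_margin_p0Profile` BY NAME at the amplitude `2B`. [folklore] -/
theorem dominance_live_of_ell_ge {A B lam₀ g : ℝ} {p q : ℕ} (hA : 0 < A) (h0 : 0 < lam₀) (hqp : q < p)
    (hg : max 1 (2 * B / (lam₀ ^ 2 * A)) ≤ Real.log (g ^ 2)⁻¹) :
    p0Profile B q g ≤ lam₀ ^ 2 / 2 * p0Profile A p g := by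
  have h := liveFactor_margin_p0Profile (A₁ := 2 * B) (A₂ := A) (lam := lam₀) hA h0 le_rfl hqp hg
  have e : p0Profile (2 * B) q g = 2 * p0Profile B q g := by
    unfold p0Profile
    ring
  rw [e] at h
  linarith

/-- … «for g_j sufficiently small» in closed form: for all `0 < g ≤ exp(−½·max 1 (2B∕(λ₀²A)))` — ONE `g⋆(λ₀)`, joining
the joint clause of `LiveFactorJointClause` (`Lit.B16Sect1SmallFactors.ell_ge_of_g_le`). [folklore] -/
theorem dominance_live_of_g_small {A B lam₀ g : ℝ} {p q : ℕ} (hA : 0 < A) (h0 : 0 < lam₀) (hqp : q < p)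
    (hg0 : 0 < g) (hg : g ≤ Real.exp (-(max 1 (2 * B / (lam₀ ^ 2 * A)) / 2))) :
    p0Profile B q g ≤ lam₀ ^ 2 / 2 * p0Profile A p g :=
  dominance_live_of_ell_ge hA h0 hqp (B16Sect1SmallFactors.ell_ge_of_g_le hg0 hg)

/-- **THE LIVE SURPLUS IN PRINT's LETTERS is half of `λ₀²` times print's**: with `κ = λ₀²∕2` the fraction of §3 is
`λ₀² − λ₀²∕2 = λ₀²∕2 ≥ 0`. [folklore] -/
theorem liveFraction_half (lam₀ : ℝ) : lam₀ ^ 2 - lam₀ ^ 2 / 2 = lam₀ ^ 2 / 2 ∧ 0 ≤ lam₀ ^ 2 / 2 :=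
  ⟨by ring, by positivity⟩

end Letters

/-! ## §5 ONE quotient for all grid assignments: the road's keyed laws for a threshold-parametric family -/

section Uniform

variable {σ ι α : Type*} {l₀ : ℝ}

/-- **THE ROAD's KEYED EXTRACTION LAWS WITH AN ASSIGNMENT-FREE QUOTIENT.**  For a threshold-parametric family (grid
assignments `c : σ`) of term families `Tm c`, non-negative weights `A c`, bad classes `Bad c`, pinned sub-classes `Badx c`
over COMMON pinned classes `X` (assignment-free keys, `LiveFactorTowerShell.carrier_eq_of_branch_eq`), extraction laws
with per-assignment quotients `q c ≤ qU` hold with the ONE quotient `qU` — so the count over the quotients is certified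
once for the whole grid (`PinnedExtraction.ExtractionLaws.mono` BY NAME). [folklore] -/
theorem extractionLaws_uniform_of_parametric {Tm : σ → ℕ → Finset ι} {A : σ → ℕ → ℝ → ι → ℝ}
    {Bad : σ → ℕ → ℝ → Finset ι} {X : ℕ → Finset α} {Badx : σ → ℕ → α → Finset ι} {q : σ → ℕ → α → ℝ}
    {qU : ℕ → α → ℝ} (h : ∀ c, ExtractionLaws l₀ (Tm c) (A c) (Bad c) X (Badx c) (q c))
    (hA : ∀ c K t, |t| ≤ l₀ → ∀ τ, 0 ≤ A c K t τ) (hq : ∀ c K, ∀ x ∈ X K, q c K x ≤ qU K x) (c : σ) :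
    ExtractionLaws l₀ (Tm c) (A c) (Bad c) X (Badx c) qU :=
  (h c).mono (hA c) (hq c)

/-- **LCS-j's QUOTIENTS AT THE LIVE LETTERS ARE ASSIGNMENT-FREE MAJORANTS**: per-assignment exponents with `λ₀²·a₁ ≤ a c`
(extraction, C1) and `b c ≤ bU` (stability, free) give `Π_{j<K} e^{b c j − a c j} ≤ Π_{j<K} e^{bU j − λ₀²·a₁ j}` — the
quotient `extractionLaws_of_LCS_of_subset` produces, dominated by ONE quotient for the whole grid. [folklore] -/
theorem prod_exp_sub_le_of_live {ac bc a₁ bU : ℕ → ℝ} {lam₀ : ℝ} (ha : ∀ j, lam₀ ^ 2 * a₁ j ≤ ac j)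
    (hb : ∀ j, bc j ≤ bU j) (K : ℕ) :
    ∏ j ∈ Finset.range K, exp (bc j - ac j) ≤ ∏ j ∈ Finset.range K, exp (bU j - lam₀ ^ 2 * a₁ j) :=
  Finset.prod_le_prod (fun j _ => (exp_pos _).le) fun j _ => exp_le_exp.2 (by linarith [ha j, hb j])

/-- … and that one quotient in closed form, with the live ledger: `Π_{j<K} e^{bU − λ₀²a₁} = e^{−Σ_{j<K}(λ₀²a₁ − bU)}`.
[folklore] -/
theorem prod_exp_live_eq {a₁ bU : ℕ → ℝ} {lam₀ : ℝ} (K : ℕ) :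
    ∏ j ∈ Finset.range K, exp (bU j - lam₀ ^ 2 * a₁ j) =
      exp (-∑ j ∈ Finset.range K, (lam₀ ^ 2 * a₁ j - bU j)) := by
  rw [← exp_sum, ← Finset.sum_neg_distrib]
  congr 1
  exact Finset.sum_congr rfl fun j _ => by ring

end Uniform

section LawsLive

variable {P : Type} [DecidableEq P] {C : ℕ → ℕ → Type} {𝒢 : (K j : ℕ) → GoodClass (C K j)}
  (T : (K : ℕ) → Tower P (C K) (𝒢 K)) (p₀ : ℕ → ℕ → P)
  (ρ₀ : (K : ℕ) → ℝ → C K 0 → ℝ) (hρ : ∀ K t, (𝒢 K 0).Gd (ρ₀ K t)) (h0 : ∀ K t x, 0 ≤ ρ₀ K t x)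
  (B : ℕ → ℝ → ℝ) (hB : ∀ K t, 0 < B K t) [∀ K j, MeasurableSpace (C K j)] (ν : (K j : ℕ) → Measure (C K j))
  {α : Type*} (S : (K : ℕ) → α → (j : ℕ) → (Fin j → P) → Finset P)
  (χ : (K : ℕ) → α → (j : ℕ) → (Fin j → P) → P → C K j → ℝ) (M : (K : ℕ) → α → ℝ → (j : ℕ) → (Fin j → P) → C K j → ℝ)
  (a b : ℕ → α → ℕ → ℝ)

/-- **THE ROAD's KEYED EXTRACTION LAWS FROM «LCS-j» AT THE LIVE LETTERS** — `LocalConditionalStability.extractionLaws_of_LCS_of_subset`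
BY NAME for ONE cutoff family of towers (the lowered-threshold run at some grid assignment; C-ρ-TOWER: its keys, key fibres
and bad classes are the assignment-free ones), whose pointwise-extraction exponents dominate `λ₀²·a₁` (C1) and whose
stability exponents sit below `bU` (free) for ASSIGNMENT-FREE tables `a₁ ∕ bU` (print's profiles read off cutoff, key and
level), the moment carriers being non-negative: `PinnedExtraction.ExtractionLaws` for run A's weights with the ONE quotient
`q K x = Π_{j<K} e^{bU K x j − λ₀²·a₁ K x j}` — the same for every grid assignment.  Every other hypothesis (sub-classes
read into pattern classes `hread`, the `hstep` identities, telescoping ∕ integrability displays) VERBATIM as in the LCS file.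
Nothing discharged. [folklore] -/
theorem extractionLaws_of_LCS_live {l₀ : ℝ} (Bad : ℕ → ℝ → Finset (HIndex.Idx (skelFam T p₀)))
    (X : ℕ → Finset α) (Badx : ℕ → α → Finset (HIndex.Idx (skelFam T p₀)))
    (hp₀ : ∀ K j g, p₀ K j ∈ (T K).branch j g)
    (bad_subset : ∀ K t, |t| ≤ l₀ → Bad K t ⊆ HIndex.termSet (skelFam T p₀) K)
    (cover : ∀ K t, |t| ≤ l₀ → ∀ τ ∈ Bad K t, ∃ x ∈ X K, τ ∈ Badx K x)
    (hread : ∀ K, ∀ x ∈ X K, Badx K x ⊆ badx T p₀ S K x)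
    (hstep : ∀ K t, |t| ≤ l₀ → ∀ x ∈ X K, ∀ j g, j < K → g ∈ admS (T K) (S K x) j → ∀ p ∈ (T K).branch j g,
      ∀ f : C K j → ℝ, (𝒢 K j).Gd f → ∫ y, ((T K).op j g p).T f y ∂ν K (j + 1) = ∫ y, χ K x j g p y * f y ∂ν K j)
    (hintχ : ∀ K t, |t| ≤ l₀ → ∀ x ∈ X K, ∀ j g, j < K → g ∈ admS (T K) (S K x) j → ∀ p ∈ (T K).branch j g,
      Integrable (fun y => χ K x j g p y * (T K).eterm (ρ₀ K t) j g y) (ν K j))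
    (hPE : ∀ K t, |t| ≤ l₀ → ∀ x ∈ X K,
      PointwiseExtraction (T K) (S K x) K (χ K x) (M K x t) (fun j _ => a K x j))
    (hLCS : ∀ K t, |t| ≤ l₀ → ∀ x ∈ X K,
      LocCondStability (T K) (S K x) K (ν K) (ρ₀ K t) (M K x t) (fun j _ => b K x j))
    (hint : ∀ K t, |t| ≤ l₀ → ∀ j g, j < K → g ∈ (T K).adm j → Integrable ((T K).eterm (ρ₀ K t) j g) (ν K j))
    (hint' : ∀ K t, |t| ≤ l₀ → ∀ j g p, j < K → g ∈ (T K).adm j → p ∈ (T K).branch j g →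
      Integrable (((T K).op j g p).T ((T K).eterm (ρ₀ K t) j g)) (ν K (j + 1)))
    (hpres : ∀ K t, |t| ≤ l₀ → ∀ j g, j < K → g ∈ (T K).adm j →
      ∫ x, (∑ p ∈ (T K).branch j g, ((T K).op j g p).T ((T K).eterm (ρ₀ K t) j g) x) ∂ν K (j + 1) =
        ∫ x, (T K).eterm (ρ₀ K t) j g x ∂ν K j)
    (hintM : ∀ K t, |t| ≤ l₀ → ∀ a', ∀ ι ∈ (skelFam T p₀ K).LIdx a',
      Integrable ((reprFam T p₀ ρ₀ hρ h0 B hB K t).eterm a' ι) (ν K K))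
    {lam₀ : ℝ} (a₁ bU : ℕ → α → ℕ → ℝ) (hM : ∀ K x t j g y, 0 ≤ M K x t j g y)
    (ha : ∀ K, ∀ x ∈ X K, ∀ j, j < K → lam₀ ^ 2 * a₁ K x j ≤ a K x j)
    (hb : ∀ K, ∀ x ∈ X K, ∀ j, j < K → b K x j ≤ bU K x j) :
    ExtractionLaws l₀ (HIndex.termSet (skelFam T p₀))
      (fun _ t => Repr172R.weight (I := skelFam T p₀) (fun K => ν K K) (reprFam T p₀ ρ₀ hρ h0 B hB) t)
      Bad X Badx (fun K x => ∏ j ∈ Finset.range K, exp (bU K x j - lam₀ ^ 2 * a₁ K x j)) :=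
  extractionLaws_of_LCS_of_subset T p₀ ρ₀ hρ h0 B hB ν S χ M (fun K x j => lam₀ ^ 2 * a₁ K x j) bU Bad X Badx hp₀
    bad_subset cover hread hstep hintχ
    (fun K t ht x hx => pointwiseExtraction_anti (hM K x t) (fun j _ hj _ => ha K x hx j hj) (hPE K t ht x hx))
    (fun K t ht x hx => locCondStability_mono (hρ K t) (h0 K t) (fun j _ hj _ => hb K x hx j hj) (hLCS K t ht x hx))
    hint hint' hpres hintM

end LawsLive

/-! ## §6 Sanity (decided toy numbers; says NOTHING about Bałaban's objects) -/

section Sanity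

/-- (S1) the step surplus is attained: `b = κ·a₁`, `aL = λ₀²·a₁` give equality in `step_surplus_live`
(`λ₀² = ¾`, `κ = ¼`, `a₁ = 8`: `(¾ − ¼)·8 = 4 = 6 − 2`). [folklore] -/
example : ((3 : ℝ) / 4 - 1 / 4) * 8 = 6 - 2 := by norm_num

/-- (S2) the quadratic live split on a one-point space: `χ ≡ 1` supported in `Q = (μ·ε)² ≥ (μ·ε)²`, `δ = 1`, `μ = λ₀ = ½`,
`ε = 2` — `1 ≤ e^{−1}·e^{1}`. [folklore] -/
example : ∑ _i ∈ ({()} : Finset Unit), (fun (_ : Unit) (_ : Unit) => (1 : ℝ)) () () ≤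
    exp (-(1 * ((1 / 2 : ℝ) ^ 2 * 2 ^ 2))) * exp (1 * (((1 / 2 : ℝ) * 2) ^ 2)) := by
  have h := chebyshev_extraction_live_sq ({()} : Finset Unit) (fun _ _ => (1 : ℝ)) (fun _ : Unit => ((1 / 2 : ℝ) * 2) ^ 2)
    (ε := 2) (δ := 1) (lam₀ := 1 / 2) (μ := 1 / 2) zero_le_one (by norm_num) le_rfl (by simp) (fun _ _ _ _ => le_rfl) ()
  simpa using h

end Sanity

end Summit.QuantumFields.BalabanUV.T4Continuum.Spine.NE7c.LiveFactorLCS
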